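import Summits.AtomisticToContinuum.Crystallization.Theorems.FrustratedLawDichotomyStrainedPatchHomLeafBridge

/-!
# The reflected (P4) fcc GRAM-LEAF CHECKER `leafOK` and its soundness (CERT-DESIGN-g44 §9 D3/D4; critic row 783 (4)(i)–(iii))

decomp-a2c hand-2 g21 (crux `AperiodicFrustratedLawGap`, stmt-AtomisticToContinuum-27623).  On top of the leaf bridge
`…HomLeafBridge.boxSum_ge_of_termChecks` (all real analysis discharged there) this module is INTEGER PLUMBING ONLY:

* hint GENERATORS `curvM`, `valLo`, `derivLo`, `derivHi` (the per-term constants are COMPUTED from the leaf data, never stored — a leaf record is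
  just `(c0, w, μ)`: 9 + 9 + 1 integers at scale `SC = 2^48`), mirroring the regime logic of `curvOK` / `valLoOK` / `derivOK`;
* the integer form of the checker inequality with OUTWARD rounding (`cdiv` for the two subtracted aggregates);
* ★ `termsOK c0 w : Bool` — the three per-term checks over the label box `[−7,7]³ ∖ 0` (a `Finset` the kernel enumerates directly), and the three integer
  AGGREGATES `sumV`, `sumG`, `sumC` of the checker inequality;
* ★★★ `leaf_sound : termsOK c0 w = true → sumV c0 = s₁ → sumG c0 w = s₂ → sumC c0 w = s₃ → μ ≤ s₁ − s₂ − s₃ → ∀ G, (Gram data of G in the box) →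
  μ/SC ≤ Σ_b W₄₅ ‖latPt G fccVec b‖` — the shard proves the four kernel facts SEPARATELY (`decide +kernel` each) and the literal comparison by `decide`.
  PILOT (farm kernel, one full leaf at the compressed fcc Gram matrix `0.92·(δᵢⱼ + ½(1−δᵢⱼ))`, half-width `2^-12`): `termsOK` ≈ 36 + 17 + 25 s for its
  three conjuncts, `sumV` ≈ 16 s, `sumG` ≈ 39 s, `sumC` ≈ 39 s; ONE `decide +kernel` over the unsplit inequality did NOT complete (error unprintable) — hence
  the split form.  The per-leaf cost (~3 min) is far above CERT-DESIGN §9's budget: the label box (3374 labels, only ≈ 450 inside the range 9/2), the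
  9-fold recomputation inside `gradA`, and `Finset` enumeration are the obvious next optimisations (list enumeration + per-term hint caching).

What is still above this file: the ENTRY→GRAM interval squaring per entry leaf (hand-1's `…HomLeafCalculus.inner_apply_apply_eq_sum_entries` in `FI`),
the prune verdicts P1–P3 in reflected form, the cover/bisection driver over `…HomCover.homFloor_of_entryCover`, and sharding.  Computable; no
instances/notation; 0 sorry; standard axioms.  `--supports stmt-AtomisticToContinuum-27623`.
-/

namespace Summit.AtomisticToContinuum.Crystallization.Theorems.FrustratedLawDichotomyStrainedPatchHomLeafCheck

open scoped BigOperators RealInnerProductSpace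
open Set
open Literature.Analysis.ValidatedNumerics.Numerics
open Summit.AtomisticToContinuum.Crystallization.Theorems.ChargedEnergyGapNegative (E3)
open Summit.AtomisticToContinuum.Crystallization.Theorems.FrustratedLawDichotomySchurCut (effPot w₄₅ ω₄)
open Summit.AtomisticToContinuum.Crystallization.Theorems.FrustratedLawDichotomyStrainedPatchHomSplit (latPt)
open Summit.AtomisticToContinuum.Crystallization.Theorems.FrustratedLawDichotomyStrainedPatchHomTermEval
open Summit.AtomisticToContinuum.Crystallization.Theorems.FrustratedLawDichotomyStrainedPatchHomTermEvalPoint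
open Summit.AtomisticToContinuum.Crystallization.Theorems.FrustratedLawDichotomyStrainedPatchHomLeafBridge (boxSum_ge_of_termChecks)
open Literature.Barriers.AtomisticToContinuum.FlatleyTheil2015 (fccVec)

/-! ## §1. Leaf data in integers -/

/-- The term functional `L_b k = bᵢ·bⱼ`, `(i, j) = finProdFinEquiv.symm k`. -/
def Lz (b : Fin 3 → ℤ) (k : Fin 9) : ℤ := b ((@finProdFinEquiv 3 3).symm k).1 * b ((@finProdFinEquiv 3 3).symm k).2

/-- Scaled centre of the term's squared-length range: `q0 = Σₖ L_b k · c0ₖ`. -/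
def q0z (c0 : Fin 9 → ℤ) (b : Fin 3 → ℤ) : ℤ := ∑ k, Lz b k * c0 k

/-- Scaled radius of the term's squared-length range: `r = Σₖ |L_b k| · wₖ`. -/
def rz (w : Fin 9 → ℤ) (b : Fin 3 → ℤ) : ℤ := ∑ k, |Lz b k| * w k

/-- The label box `[−7,7]³ ∖ 0`. -/
noncomputable def box7 : Finset (Fin 3 → ℤ) := (Fintype.piFinset fun _ : Fin 3 => Finset.Icc (-7 : ℤ) 7).filter (fun b => b ≠ 0)

/-! ## §2. Hint generators (any value is SOUND — the checks decide; these just aim to pass) -/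

/-- Curvature constant generator: the regime expression's upper end (max of the two pieces on a straddle), floored at `0`. -/
def curvM (qlo qhi : ℤ) : ℤ :=
  let A := FI.ofScaled qlo
  let B := FI.ofScaled qhi
  max 0
    (if 25 * qhi ≤ 64 * (SC : ℤ) then (eBump A B (FI.sqrt A).lo (FI.sqrt B).hi).hi
    else if 64 * (SC : ℤ) ≤ 25 * qlo then
      (if qhi ≤ 9 * (SC : ℤ) then (eLJ A B).hi
      else if 9 * (SC : ℤ) ≤ qlo then
        (if 4 * qhi ≤ 81 * (SC : ℤ) then (eWin (FI.sqrt A).lo (FI.sqrt B).hi).hi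
        else if 81 * (SC : ℤ) ≤ 4 * qlo then 0
        else (eWin (FI.sqrt A).lo (FI.sqrt (FI.ofFrac 81 4)).hi).hi)
      else max (eLJ A (FI.ofInt 9)).hi (eWin (FI.sqrt (FI.ofInt 9)).lo (FI.sqrt B).hi).hi)
    else max (eBump A (FI.ofFrac 64 25) (FI.sqrt A).lo (FI.sqrt (FI.ofFrac 64 25)).hi).hi (eLJ (FI.ofFrac 64 25) B).hi)

/-- Value lower-bound generator (the regime enclosure's lower end). -/
def valLo (q0 : ℤ) : ℤ :=
  let Q := FI.ofScaled q0
  if 25 * q0 ≤ 64 * (SC : ℤ) then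
    (eBumpE1 Q).lo + min (FI.mul (eBumpC Q) (mulRat (FI.ofScaled (FI.sqrt Q).lo) 5 4)).lo
      (FI.mul (eBumpC Q) (mulRat (FI.ofScaled (FI.sqrt Q).hi) 5 4)).lo
  else if q0 ≤ 9 * (SC : ℤ) then (eVq Q).lo
  else if 4 * q0 ≤ 81 * (SC : ℤ) then (eWinVal Q (FI.sqrt Q).hi).lo
  else 0

/-- Derivative lower-end generator. -/
def derivLo (q0 : ℤ) : ℤ :=
  let Q := FI.ofScaled q0
  if 25 * q0 ≤ 64 * (SC : ℤ) then
    (eBumpE2 Q).lo + min (FI.mul (eBumpC2 Q) (mulRat (FI.ofScaled (FI.sqrt Q).lo) 5 4)).lo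
      (FI.mul (eBumpC2 Q) (mulRat (FI.ofScaled (FI.sqrt Q).hi) 5 4)).lo
  else if q0 ≤ 9 * (SC : ℤ) then (eGlj Q).lo
  else if 4 * q0 ≤ 81 * (SC : ℤ) then (eWinDer (FI.sqrt Q).hi (FI.sqrt Q).lo).lo
  else 0

/-- Derivative upper-end generator. -/
def derivHi (q0 : ℤ) : ℤ :=
  let Q := FI.ofScaled q0
  if 25 * q0 ≤ 64 * (SC : ℤ) then
    (eBumpE2 Q).hi + max (FI.mul (eBumpC2 Q) (mulRat (FI.ofScaled (FI.sqrt Q).lo) 5 4)).hi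
      (FI.mul (eBumpC2 Q) (mulRat (FI.ofScaled (FI.sqrt Q).hi) 5 4)).hi
  else if q0 ≤ 9 * (SC : ℤ) then (eGlj Q).hi
  else if 4 * q0 ≤ 81 * (SC : ℤ) then (eWinDer (FI.sqrt Q).lo (FI.sqrt Q).hi).hi
  else 0

/-! ## §3. The integer checker inequality and the leaf check -/

/-- Scaled upper bound `A k` of `SC·Σ_b max |Dlo·L| |Dhi·L|`: `Σ_b max |derivLo·L_bk| |derivHi·L_bk|`. -/
noncomputable def gradA (c0 : Fin 9 → ℤ) (k : Fin 9) : ℤ :=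
  ∑ b ∈ box7, max |derivLo (q0z c0 b) * Lz b k| |derivHi (q0z c0 b) * Lz b k|

/-- ★ **PER-TERM PART OF THE LEAF CHECK**: half-widths non-negative and, for every label, the three reflected term checks pass on the generated hints. -/
noncomputable def termsOK (c0 w : Fin 9 → ℤ) : Bool :=
  decide (∀ k, 0 ≤ w k) &&
  decide (∀ b ∈ box7,
    curvOK (q0z c0 b - rz w b) (q0z c0 b + rz w b) (curvM (q0z c0 b - rz w b) (q0z c0 b + rz w b)) = true ∧
    valLoOK (q0z c0 b) (valLo (q0z c0 b)) = true ∧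
    derivOK (q0z c0 b) (derivLo (q0z c0 b)) (derivHi (q0z c0 b)) = true)

/-- Aggregate 1 (scaled): `Σ_b valLo`. -/
noncomputable def sumV (c0 : Fin 9 → ℤ) : ℤ := ∑ b ∈ box7, valLo (q0z c0 b)

/-- Aggregate 2 (scaled, rounded UP): `Σₖ ⌈gradA k · wₖ / SC⌉`. -/
noncomputable def sumG (c0 w : Fin 9 → ℤ) : ℤ := ∑ k, cdiv (gradA c0 k * w k) SC

/-- Aggregate 3 (scaled, rounded UP): `⌈Σ_b curvM_b · r_b² / (2·SC²)⌉`. -/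
noncomputable def sumC (c0 w : Fin 9 → ℤ) : ℤ :=
  cdiv (∑ b ∈ box7, curvM (q0z c0 b - rz w b) (q0z c0 b + rz w b) * rz w b ^ 2) (2 * (SC : ℤ) * SC)

/-! ## §4. Soundness -/

/-- ★★★ **SOUNDNESS OF THE LEAF CHECK.**  A shard supplies, per Gram leaf `(c0, w)` with target `μ`: the kernel fact `termsOK c0 w = true`, the three
kernel-evaluated aggregates `sumV c0 = s₁`, `sumG c0 w = s₂`, `sumC c0 w = s₃` (separate `decide +kernel` facts — measured ≈ 16 s / 39 s / 39 s per
3374-label leaf on the farm kernel, see the module's pilot note) and the literal comparison `μ ≤ s₁ − s₂ − s₃`; conclusion: the (P4) box floor of that leaf for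
every deformation whose Gram data lie in the box. [folklore] -/
theorem leaf_sound {c0 w : Fin 9 → ℤ} {μ s₁ s₂ s₃ : ℤ} (h : termsOK c0 w = true) (e₁ : sumV c0 = s₁) (e₂ : sumG c0 w = s₂) (e₃ : sumC c0 w = s₃)
    (hineq : μ ≤ s₁ - s₂ - s₃) (G : E3 →L[ℝ] E3)
    (hbox : ∀ k : Fin 9, |⟪G (fccVec ((@finProdFinEquiv 3 3).symm k).1), G (fccVec ((@finProdFinEquiv 3 3).symm k).2)⟫ - (c0 k : ℝ) / SC| ≤
      (w k : ℝ) / SC) :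
    (μ : ℝ) / SC ≤ ∑ b ∈ (Fintype.piFinset fun _ : Fin 3 => Finset.Icc (-7 : ℤ) 7).filter (fun b => b ≠ 0), effPot w₄₅ ω₄ (3 / 400) ‖latPt G fccVec b‖ := by
  subst e₁ e₂ e₃
  unfold termsOK at h
  simp only [Bool.and_eq_true, decide_eq_true_eq] at h
  obtain ⟨hw, hterms⟩ := h
  have hS := SC_pos
  have hS2 : (0:ℤ) < 2 * (SC : ℤ) * SC := mul_pos (mul_pos two_pos SCZ_pos) SCZ_pos
  refine boxSum_ge_of_termChecks c0 w (fun b => curvM (q0z c0 b - rz w b) (q0z c0 b + rz w b)) (fun b => valLo (q0z c0 b))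
    (fun b => derivLo (q0z c0 b)) (fun b => derivHi (q0z c0 b)) μ hw (fun b hb => (hterms b hb).1) (fun b hb => (hterms b hb).2.1)
    (fun b hb => (hterms b hb).2.2) ?_ G hbox
  -- the integer inequality, read in ℝ with outward rounding
  have hI : (μ : ℝ) ≤ ((∑ b ∈ box7, valLo (q0z c0 b) : ℤ) : ℝ) - ((∑ k, cdiv (gradA c0 k * w k) SC : ℤ) : ℝ) -
      ((cdiv (∑ b ∈ box7, curvM (q0z c0 b - rz w b) (q0z c0 b + rz w b) * rz w b ^ 2) (2 * (SC : ℤ) * SC) : ℤ) : ℝ) := by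
    unfold sumV sumG sumC at hineq; exact_mod_cast hineq
  -- piece 2: Σ_k (Σ_b max …/SC) · (w k/SC) ≤ (Σ_k cdiv (A_k w_k) SC)/SC
  have h2 : ∑ k, (∑ b ∈ box7, max (|((derivLo (q0z c0 b) : ℝ) / SC) * (((b ((@finProdFinEquiv 3 3).symm k).1 : ℤ) : ℝ) *
        ((b ((@finProdFinEquiv 3 3).symm k).2 : ℤ) : ℝ))|) (|((derivHi (q0z c0 b) : ℝ) / SC) * (((b ((@finProdFinEquiv 3 3).symm k).1 : ℤ) : ℝ) *
        ((b ((@finProdFinEquiv 3 3).symm k).2 : ℤ) : ℝ))|)) * ((w k : ℝ) / SC) ≤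
      ((∑ k, cdiv (gradA c0 k * w k) SC : ℤ) : ℝ) / SC := by
    rw [Int.cast_sum, Finset.sum_div]
    refine Finset.sum_le_sum fun k _ => ?_
    have hA : (∑ b ∈ box7, max (|((derivLo (q0z c0 b) : ℝ) / SC) * (((b ((@finProdFinEquiv 3 3).symm k).1 : ℤ) : ℝ) *
        ((b ((@finProdFinEquiv 3 3).symm k).2 : ℤ) : ℝ))|) (|((derivHi (q0z c0 b) : ℝ) / SC) * (((b ((@finProdFinEquiv 3 3).symm k).1 : ℤ) : ℝ) *
        ((b ((@finProdFinEquiv 3 3).symm k).2 : ℤ) : ℝ))|)) = ((gradA c0 k : ℤ) : ℝ) / SC := by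
      unfold gradA Lz
      rw [Int.cast_sum, Finset.sum_div]
      refine Finset.sum_congr rfl fun b _ => ?_
      have e1 : ∀ D : ℤ, |((D : ℝ) / SC) * (((b ((@finProdFinEquiv 3 3).symm k).1 : ℤ) : ℝ) * ((b ((@finProdFinEquiv 3 3).symm k).2 : ℤ) : ℝ))| =
          ((|D * (b ((@finProdFinEquiv 3 3).symm k).1 * b ((@finProdFinEquiv 3 3).symm k).2)| : ℤ) : ℝ) / SC := by
        intro D
        rw [Int.cast_abs, ← abs_of_pos hS, ← abs_div, abs_of_pos hS]
        congr 1; push_cast; field_simp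
      rw [e1, e1, Int.cast_max, max_div_div_right hS.le]
    rw [hA]
    have := div_le_cdiv (a := gradA c0 k * w k) (b := (SC : ℤ)) (by exact_mod_cast SCZ_pos)
    push_cast at this
    calc ((gradA c0 k : ℤ) : ℝ) / SC * ((w k : ℝ) / SC) = ((gradA c0 k : ℝ) * (w k) / SC) / SC := by field_simp
      _ ≤ ((cdiv (gradA c0 k * w k) SC : ℤ) : ℝ) / SC := div_le_div_of_nonneg_right this hS.le
  -- piece 3: ½ Σ (M/SC)(r/SC)² ≤ cdiv(Σ M r², 2 SC²)/SC
  have h3 : 1 / 2 * ∑ b ∈ box7, ((curvM (q0z c0 b - rz w b) (q0z c0 b + rz w b) : ℝ) / SC) *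
        (∑ k, |((b ((@finProdFinEquiv 3 3).symm k).1 : ℤ) : ℝ) * ((b ((@finProdFinEquiv 3 3).symm k).2 : ℤ) : ℝ)| * ((w k : ℝ) / SC)) ^ 2 ≤
      ((cdiv (∑ b ∈ box7, curvM (q0z c0 b - rz w b) (q0z c0 b + rz w b) * rz w b ^ 2) (2 * (SC : ℤ) * SC) : ℤ) : ℝ) / SC := by
    have hr : ∀ b : Fin 3 → ℤ, ∑ k, |((b ((@finProdFinEquiv 3 3).symm k).1 : ℤ) : ℝ) * ((b ((@finProdFinEquiv 3 3).symm k).2 : ℤ) : ℝ)| *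
        ((w k : ℝ) / SC) = ((rz w b : ℤ) : ℝ) / SC := by
      intro b; unfold rz Lz; push_cast; rw [Finset.sum_div]; exact Finset.sum_congr rfl fun k _ => by ring
    simp only [hr]
    have := div_le_cdiv (a := ∑ b ∈ box7, curvM (q0z c0 b - rz w b) (q0z c0 b + rz w b) * rz w b ^ 2) (b := 2 * (SC : ℤ) * SC) hS2
    have e : 1 / 2 * ∑ b ∈ box7, ((curvM (q0z c0 b - rz w b) (q0z c0 b + rz w b) : ℝ) / SC) * (((rz w b : ℤ) : ℝ) / SC) ^ 2 =
        (((∑ b ∈ box7, curvM (q0z c0 b - rz w b) (q0z c0 b + rz w b) * rz w b ^ 2 : ℤ) : ℝ) / ((2 * (SC : ℤ) * SC : ℤ) : ℝ)) / SC := by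
      push_cast
      rw [Finset.mul_sum, Finset.sum_div, Finset.sum_div]
      refine Finset.sum_congr rfl fun b _ => ?_
      field_simp
    rw [e]
    exact div_le_div_of_nonneg_right this hS.le
  -- piece 1 is an identity
  have h1 : ∑ b ∈ box7, ((valLo (q0z c0 b) : ℝ)) / SC = ((∑ b ∈ box7, valLo (q0z c0 b) : ℤ) : ℝ) / SC := by
    rw [Int.cast_sum, Finset.sum_div]
  have hI' := div_le_div_of_nonneg_right hI hS.le
  rw [sub_div, sub_div] at hI'
  simp only [box7] at h1 h2 h3 hI' ⊢
  linarith [h1, h2, h3, hI']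

/-! ## §5. Kernel smoke tests -/

/-- The hint generators pass their own checks on a first-shell term `q ∈ [0.9, 0.905]` and on a window term `q ∈ [12, 12.05]` (kernel). -/
example : curvOK (9 * (SC : ℤ) / 10) (905 * (SC : ℤ) / 1000) (curvM (9 * (SC : ℤ) / 10) (905 * (SC : ℤ) / 1000)) = true ∧
    curvOK (12 * (SC : ℤ)) (12 * (SC : ℤ) + (SC : ℤ) / 20) (curvM (12 * (SC : ℤ)) (12 * (SC : ℤ) + (SC : ℤ) / 20)) = true := by
  decide +kernel

/-- … and the value / derivative generators at `q₀ = 0.95`, `3`, `12`, `25`. -/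
example : (valLoOK (95 * (SC : ℤ) / 100) (valLo (95 * (SC : ℤ) / 100)) && derivOK (95 * (SC : ℤ) / 100) (derivLo (95 * (SC : ℤ) / 100))
      (derivHi (95 * (SC : ℤ) / 100)) && valLoOK (3 * (SC : ℤ)) (valLo (3 * (SC : ℤ))) && valLoOK (12 * (SC : ℤ)) (valLo (12 * (SC : ℤ))) &&
      derivOK (12 * (SC : ℤ)) (derivLo (12 * (SC : ℤ))) (derivHi (12 * (SC : ℤ))) && valLoOK (25 * (SC : ℤ)) (valLo (25 * (SC : ℤ)))) = true := by
  decide +kernel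

end Summit.AtomisticToContinuum.Crystallization.Theorems.FrustratedLawDichotomyStrainedPatchHomLeafCheck
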